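import Summits.ValiantsHypothesis.ValiantsHypothesis.Theorems.LacunarySymmetroidMatrixDescartesCensusDoorA34SheetTwistedBlocks
import Summits.ValiantsHypothesis.ValiantsHypothesis.Theorems.LacunarySymmetroidMatrixDescartesCensusDoorA34SheetSemidefPairLaw
import Summits.ValiantsHypothesis.ValiantsHypothesis.Theorems.LacunarySymmetroidMatrixDescartesCensusDoorA34SheetWindowGramPrinciple
import Summits.ValiantsHypothesis.ValiantsHypothesis.Theorems.LacunarySymmetroidMatrixDescartesCensusBlockCone

/-!
# `MatrixDescartes` census — DOOR A at `(3,4)`: the TWISTED MIDDLE WINDOW OF A NULL-TOP EIGHTEEN IS GRAM-ORIENTED —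
# a magnitude-level certificate on the generic sheet, in EVERY inertia cell and every gap, and the closed «anti-oriented» half of the sheet

HONEST FRAMING.  Object-search cell `pub-symmetroid`, engine seat `val-sym-eng-2` (g12); helper rows beside the registered strata line
`Cruxes/DoorA34/Lines/strata.lean` on stmt-ValiantsHypothesis-19980 (`DoorA34 = PosRootLawAt 3 4 18`: OPEN, typed, never asserted here), second stub
`stub_nullTopCeiling` (`det S₃ = 0 ⇒ ≤ 17`), OPEN on the generic sheet `tr(adj S₃·S₂) ≠ 0` (p575885).  This file CHAINS two kernel rows of the line that were
landed by different seats and never composed: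

* g8's TWISTED BLOCK ANATOMY (`Census.twistedBlock_sharp_of_nullTop_eighteen`, …SheetTwistedBlocks): if `det S₃ = 0` and the pencil has `18` distinct positive
  roots then the Euler-twisted MIDDLE WINDOW — the six slots `{3,i,j}`, `i ≤ j < 3`, with exponents `d₃ + dᵢ + dⱼ`, each coefficient multiplied by the
  weight `W(n) = ∏ (n − σ(u))` over the exponents of the thirteen other slots — has EXACTLY five distinct positive roots, in every exponent chamber;
* g11's GRAM ORIENTATION PRINCIPLE (`Census.orientation_eq_sign_gramDet` / `…_mirror`, …SheetWindowGramPrinciple): ANY real six-nomial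
  `c₀ + c₁x^{a} + c₂x^{2a} + c₃x^{b} + c₄x^{a+b} + c₅x^{2b}` with five distinct positive roots has Gram determinant
  `Δ = c₀c₂c₅ + c₁c₃c₄/4 − c₀c₄²/4 − c₂c₃²/4 − c₅c₁²/4 ≠ 0` with `0 < c₅Δ`, `c₀Δ < 0`, `c₂Δ < 0` on a WINDOW-shaped support (`0 < a`, `2a < b`), resp.
  `0 < c₀Δ`, `c₅Δ < 0`, `c₂Δ < 0` on a MIRROR-shaped one (`a < b < 2a`).

Results (any real `3 × 3` letters — symmetry is not used —, sorted support `d`, gaps `a = d₁ − d₀`, `b = d₂ − d₀`; `d₃` arbitrary: window-ordered, small-gap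
and interleaved chambers alike; both inertia cells of the top letter alike):

* `midSlots_eq` — the six middle slots (positive roots survive the monomial factor: `Census.posRoots_X_pow_mul`, …CensusBlockCone);
* **`twistedMiddle_five_roots_of_nullTop_eighteen`** — `det S₃ = 0`, `18` roots, `2a ≠ b` ⇒ the twisted middle six-nomial
  `c̃₀ + c̃₁x^a + c̃₂x^{2a} + c̃₃x^b + c̃₄x^{a+b} + c̃₅x^{2b}`, `c̃ᵢ = W(d₃+σᵢ)·coeff(d₃+σᵢ)` (`σ = 2d₀, d₀+d₁, 2d₁, d₀+d₂, d₁+d₂, 2d₂`), has at least five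
  distinct positive roots (the twisted block of g8 divided by `x^{d₃+2d₀}`);
* **`twistedMiddle_gram_orientation_of_nullTop_eighteen`** (window core `2a < b`) / **`…_mirror`** (`a < b < 2a`) — hence its Gram determinant `Δ̃` is
  non-zero and ORIENTED: `0 < c̃₅Δ̃ ∧ c̃₀Δ̃ < 0 ∧ c̃₂Δ̃ < 0` (window), `0 < c̃₀Δ̃ ∧ c̃₅Δ̃ < 0 ∧ c̃₂Δ̃ < 0` (mirror) — a CUBIC magnitude inequality in the six
  middle slot coefficients, beyond the sign level (the atlas) and beside g8's top-trinomial inequality (`topTrinomial_ineq_of_nullTop_eighteen`);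
* `middle_coeffs_eq_traces_of_nullTop_eighteen` — the six middle coefficients in letters: `tr(adj S₀·S₃)`, `tr(B(S₀,S₁)·S₃)`, `tr(adj S₁·S₃)`,
  `tr(B(S₀,S₂)·S₃)`, `tr(B(S₁,S₂)·S₃)`, `tr(adj S₂·S₃)` with the polarised adjugate `B(X,Y) = adj(X+Y) − adj X − adj Y` (rows `coeff_square_of_nullTop_eighteen`,
  `coeff_mixed_of_nullTop_eighteen` of …SheetRankParity / …SheetSemidefPairLaw);
* **`posRoots_le_17_of_nullTop_of_twistedMiddle_antiOriented`** (window) / **`…_mirror`** — THE CERTIFICATE: on the generic sheet, every pencil whose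
  twisted middle window (computed from the LETTERS and `d` alone) is NOT Gram-oriented — `c̃₅·Δ̃ ≤ 0` on window cores, `c̃₀·Δ̃ ≤ 0` on mirror cores — has at most
  `17` distinct positive roots.  This closes a full-dimensional semialgebraic HALF of the generic sheet for the stub, in every cell and every chamber with
  `2a ≠ b` (the hyperplane `2a = b` merges two middle slots and is closed by monomial count, `Census.sym_sum_injOn_of_nullTop_eighteen`).

LOCATED COMPANION (this seat, exact arithmetic, report HOME/DOOR-A34-ENG2G12-REPORT.md §2): on the window rail `(0,1,4,N)` the middle window of EVERY record with
fewer than five middle roots is anti-oriented or Gram-degenerate — NullTopSeventeen `(0,1,4,359)` and `014100`, SemidefSixteen, SubStratumSixteen (`c̃₅Δ̃ < 0`,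
`|Δ̃|/Σ|terms| = 7·10⁻⁴ … 10⁻¹`) and the cancellation object SemidefSixteen01440 (`Δ̃/Σ|terms| = −2·10⁻⁶`: its middle Gram form is all but SINGULAR) — while the two
objects with a fully alternating five-root middle window (FlagFiveSixteen, RankOneFifteen) are oriented (`c̃₅Δ̃ > 0`) and are capped at the TOP window instead
(orientation law / `topWindow_ne_zero_beyond_semidef_middle_roots`).  So the records' missing fifth middle root (the middle-pair law of g10) is, at magnitude level,
the failure of middle Gram orientation.

Nothing here bounds `ζ_sym(3,4)`; `DoorA34` and the three stubs stay OPEN; registers unchanged (`ζ_sym(3,4) ∈ {18,19}`); nothing on `MatrixDescartes`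
(stmt-ValiantsHypothesis-18050) or on `VP ≠ VNP` — VP≠VNP not moved.  [folklore] Rolle twists + Descartes sharpness + the Gram orientation principle; no single source.
-/

-- `Summit.ValiantsHypothesis.ValiantsHypothesis.…` repeats a component by the D-0017 layout
-- (single-conjunct summit), which the `dupNamespace` linter flags; the name is mandated.
set_option linter.dupNamespace false

namespace Summit.ValiantsHypothesis.ValiantsHypothesis.Theorems.LacunarySymmetroidMatrixDescartes.Census

open Polynomial Finset
open scoped BigOperators Polynomial Matrix

/-! ## 1. Bookkeeping -/

/-- The six MIDDLE slots of the null-top sheet (exactly one copy of the top letter). [folklore] -/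
theorem midSlots_eq :
    (Finset.univ : Finset (Sym (Fin 4) 3)).filter (fun s : Sym (Fin 4) 3 => Multiset.count 3 (s : Multiset (Fin 4)) = 1)
      = {⟨{3, 0, 0}, by simp⟩, ⟨{3, 0, 1}, by simp⟩, ⟨{3, 1, 1}, by simp⟩, ⟨{3, 0, 2}, by simp⟩, ⟨{3, 1, 2}, by simp⟩, ⟨{3, 2, 2}, by simp⟩} := by
  decide

/-! ## 2. The twisted middle window of an eighteen has five positive roots -/

/-- **FIVE ROOTS OF THE TWISTED MIDDLE WINDOW.**  Sorted support with gaps `d₁ = d₀ + a`, `d₂ = d₀ + b` (`2a ≠ b`), any real letters, `det S₃ = 0`, `18` distinct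
positive roots.  With the twist weights `W(n) = ∏ (n − σ(u))` over the (distinct) exponents `σ(u)` of the thirteen slots `u ≠ {3,3,3}` OUTSIDE the middle window and
`c̃ᵢ = W(d₃ + σᵢ)·coeff(d₃ + σᵢ)` for `σ = (2d₀, d₀+d₁, 2d₁, d₀+d₂, d₁+d₂, 2d₂)`, the six-nomial `c̃₀ + c̃₁x^a + c̃₂x^{2a} + c̃₃x^b + c̃₄x^{a+b} + c̃₅x^{2b}` has at
least five distinct positive roots. [folklore] -/
theorem twistedMiddle_five_roots_of_nullTop_eighteen (d : Fin 4 → ℕ) (hd : StrictMono d) (S : Fin 4 → Matrix (Fin 3) (Fin 3) ℝ)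
    (h3 : (S 3).det = 0)
    (h18 : 18 ≤ ((Matrix.det (∑ l, ((X : ℝ[X]) ^ d l) • (S l).map C)).roots.toFinset.filter (fun t => 0 < t)).card)
    {a b : ℕ} (ha : d 1 = d 0 + a) (hb : d 2 = d 0 + b) (h2ab : 2 * a ≠ b)
    (W : ℕ → ℝ) (hW : ∀ n, W n =
      ∏ E ∈ ((((Finset.univ : Finset (Sym (Fin 4) 3)).erase (Sym.replicate 3 3)).filter
          (fun s : Sym (Fin 4) 3 => Multiset.count 3 (s : Multiset (Fin 4)) ≠ 1)).image
          (fun s : Sym (Fin 4) 3 => ((s : Multiset (Fin 4)).map d).sum)).image (fun m : ℕ => (m : ℝ)), ((n : ℝ) - E))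
    (c₀ c₁ c₂ c₃ c₄ c₅ : ℝ)
    (hc₀ : c₀ = W (d 3 + 2 * d 0) * (Matrix.det (∑ l, ((X : ℝ[X]) ^ d l) • (S l).map C)).coeff (d 3 + 2 * d 0))
    (hc₁ : c₁ = W (d 3 + d 0 + d 1) * (Matrix.det (∑ l, ((X : ℝ[X]) ^ d l) • (S l).map C)).coeff (d 3 + d 0 + d 1))
    (hc₂ : c₂ = W (d 3 + 2 * d 1) * (Matrix.det (∑ l, ((X : ℝ[X]) ^ d l) • (S l).map C)).coeff (d 3 + 2 * d 1))
    (hc₃ : c₃ = W (d 3 + d 0 + d 2) * (Matrix.det (∑ l, ((X : ℝ[X]) ^ d l) • (S l).map C)).coeff (d 3 + d 0 + d 2))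
    (hc₄ : c₄ = W (d 3 + d 1 + d 2) * (Matrix.det (∑ l, ((X : ℝ[X]) ^ d l) • (S l).map C)).coeff (d 3 + d 1 + d 2))
    (hc₅ : c₅ = W (d 3 + 2 * d 2) * (Matrix.det (∑ l, ((X : ℝ[X]) ^ d l) • (S l).map C)).coeff (d 3 + 2 * d 2)) :
    5 ≤ (((C c₀ * X ^ 0 + C c₁ * X ^ a + C c₂ * X ^ (2 * a) + C c₃ * X ^ b + C c₄ * X ^ (a + b) + C c₅ * X ^ (2 * b) : ℝ[X])).roots.toFinset.filter
      (fun t => 0 < t)).card := by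
  have ha0 : 0 < a := by have := hd (show (0 : Fin 4) < 1 by decide); omega
  have hab : a < b := by have := hd (show (1 : Fin 4) < 2 by decide); omega
  obtain ⟨g, hg, hsupp, hZ⟩ := twistedBlock_sharp_of_nullTop_eighteen d S h3 h18 1 (by norm_num)
  have hcardB : ((Finset.univ : Finset (Sym (Fin 4) 3)).filter
      (fun s : Sym (Fin 4) 3 => Multiset.count 3 (s : Multiset (Fin 4)) = 1)).card = 6 := by
    rw [midSlots_eq]; decide
  rw [hcardB] at hZ
  -- the middle window's exponents
  have hmemB : ∀ n ∈ g.support, n = d 3 + 2 * d 0 ∨ n = d 3 + d 0 + d 1 ∨ n = d 3 + 2 * d 1 ∨ n = d 3 + d 0 + d 2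
      ∨ n = d 3 + d 1 + d 2 ∨ n = d 3 + 2 * d 2 := by
    intro n hn
    have h := hsupp hn
    rw [midSlots_eq] at h
    simp only [Finset.image_insert, Finset.image_singleton, Finset.mem_insert, Finset.mem_singleton, Sym.coe_mk,
      Multiset.insert_eq_cons, Multiset.map_cons, Multiset.sum_cons, Multiset.map_singleton, Multiset.sum_singleton] at h
    omega
  -- coefficients of `g` on the middle window
  have hcoef : ∀ n, g.coeff n = W n * (Matrix.det (∑ l, ((X : ℝ[X]) ^ d l) • (S l).map C)).coeff n := by
    intro n; rw [hg, hW]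
  -- the six exponents are pairwise distinct (`2a ≠ b`)
  have e1 : d 3 + d 0 + d 1 = d 3 + 2 * d 0 + a := by omega
  have e2 : d 3 + 2 * d 1 = d 3 + 2 * d 0 + 2 * a := by omega
  have e3 : d 3 + d 0 + d 2 = d 3 + 2 * d 0 + b := by omega
  have e4 : d 3 + d 1 + d 2 = d 3 + 2 * d 0 + (a + b) := by omega
  have e5 : d 3 + 2 * d 2 = d 3 + 2 * d 0 + 2 * b := by omega
  -- `g` is the monomial `X^{d₃+2d₀}` times the six-nomial
  have hgeq : g = X ^ (d 3 + 2 * d 0) *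
      (C c₀ * X ^ 0 + C c₁ * X ^ a + C c₂ * X ^ (2 * a) + C c₃ * X ^ b + C c₄ * X ^ (a + b) + C c₅ * X ^ (2 * b)) := by
    have hg6 : g = C c₀ * X ^ (d 3 + 2 * d 0) + C c₁ * X ^ (d 3 + 2 * d 0 + a) + C c₂ * X ^ (d 3 + 2 * d 0 + 2 * a)
        + C c₃ * X ^ (d 3 + 2 * d 0 + b) + C c₄ * X ^ (d 3 + 2 * d 0 + (a + b)) + C c₅ * X ^ (d 3 + 2 * d 0 + 2 * b) := by
      ext n
      simp only [coeff_add, coeff_C_mul, coeff_X_pow]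
      by_cases h0 : n = d 3 + 2 * d 0
      · subst h0
        rw [hcoef, ← hc₀, if_pos rfl, if_neg (by omega), if_neg (by omega), if_neg (by omega), if_neg (by omega), if_neg (by omega)]
        ring
      by_cases h1 : n = d 3 + 2 * d 0 + a
      · subst h1
        rw [hcoef, ← e1, ← hc₁, if_neg (by omega), e1, if_pos rfl, if_neg (by omega), if_neg (by omega), if_neg (by omega),
          if_neg (by omega)]
        ring
      by_cases h2 : n = d 3 + 2 * d 0 + 2 * a
      · subst h2
        rw [hcoef, ← e2, ← hc₂, if_neg (by omega), if_neg (by omega), e2, if_pos rfl, if_neg (by omega), if_neg (by omega),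
          if_neg (by omega)]
        ring
      by_cases h3' : n = d 3 + 2 * d 0 + b
      · subst h3'
        rw [hcoef, ← e3, ← hc₃, if_neg (by omega), if_neg (by omega), if_neg (by omega), e3, if_pos rfl, if_neg (by omega),
          if_neg (by omega)]
        ring
      by_cases h4 : n = d 3 + 2 * d 0 + (a + b)
      · subst h4
        rw [hcoef, ← e4, ← hc₄, if_neg (by omega), if_neg (by omega), if_neg (by omega), if_neg (by omega), e4, if_pos rfl,
          if_neg (by omega)]
        ring
      by_cases h5 : n = d 3 + 2 * d 0 + 2 * b
      · subst h5
        rw [hcoef, ← e5, ← hc₅, if_neg (by omega), if_neg (by omega), if_neg (by omega), if_neg (by omega), if_neg (by omega),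
          e5, if_pos rfl]
        ring
      have hn : n ∉ g.support := fun hn => by
        rcases hmemB n hn with h | h | h | h | h | h <;> omega
      rw [notMem_support_iff.mp hn, if_neg h0, if_neg h1, if_neg h2, if_neg h3', if_neg h4, if_neg h5]
      ring
    rw [hg6]
    simp only [pow_add, pow_zero, mul_one]
    ring
  have hq : (C c₀ * X ^ 0 + C c₁ * X ^ a + C c₂ * X ^ (2 * a) + C c₃ * X ^ b + C c₄ * X ^ (a + b) + C c₅ * X ^ (2 * b) : ℝ[X]) ≠ 0 := by
    intro hq
    rw [hgeq, hq, mul_zero, roots_zero, Multiset.toFinset_zero, Finset.filter_empty, Finset.card_empty] at hZ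
    omega
  rw [hgeq, posRoots_X_pow_mul (d 3 + 2 * d 0) _ hq] at hZ
  omega

/-! ## 3. Gram orientation of the twisted middle window -/

/-- **TWISTED MIDDLE GRAM ORIENTATION OF A NULL-TOP EIGHTEEN — WINDOW-shaped core (`0 < a`, `2a < b`).**  Same data: the Gram determinant
`Δ̃ = c̃₀c̃₂c̃₅ + c̃₁c̃₃c̃₄/4 − c̃₀c̃₄²/4 − c̃₂c̃₃²/4 − c̃₅c̃₁²/4` of the twisted middle window satisfies `0 < c̃₅Δ̃`, `c̃₀Δ̃ < 0`, `c̃₂Δ̃ < 0`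
(in particular `Δ̃ ≠ 0`).  Every inertia cell, every `d₃`. [folklore] -/
theorem twistedMiddle_gram_orientation_of_nullTop_eighteen (d : Fin 4 → ℕ) (hd : StrictMono d) (S : Fin 4 → Matrix (Fin 3) (Fin 3) ℝ)
    (h3 : (S 3).det = 0)
    (h18 : 18 ≤ ((Matrix.det (∑ l, ((X : ℝ[X]) ^ d l) • (S l).map C)).roots.toFinset.filter (fun t => 0 < t)).card)
    {a b : ℕ} (ha : d 1 = d 0 + a) (hb : d 2 = d 0 + b) (hw : 2 * a < b)
    (W : ℕ → ℝ) (hW : ∀ n, W n =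
      ∏ E ∈ ((((Finset.univ : Finset (Sym (Fin 4) 3)).erase (Sym.replicate 3 3)).filter
          (fun s : Sym (Fin 4) 3 => Multiset.count 3 (s : Multiset (Fin 4)) ≠ 1)).image
          (fun s : Sym (Fin 4) 3 => ((s : Multiset (Fin 4)).map d).sum)).image (fun m : ℕ => (m : ℝ)), ((n : ℝ) - E))
    (c₀ c₁ c₂ c₃ c₄ c₅ : ℝ)
    (hc₀ : c₀ = W (d 3 + 2 * d 0) * (Matrix.det (∑ l, ((X : ℝ[X]) ^ d l) • (S l).map C)).coeff (d 3 + 2 * d 0))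
    (hc₁ : c₁ = W (d 3 + d 0 + d 1) * (Matrix.det (∑ l, ((X : ℝ[X]) ^ d l) • (S l).map C)).coeff (d 3 + d 0 + d 1))
    (hc₂ : c₂ = W (d 3 + 2 * d 1) * (Matrix.det (∑ l, ((X : ℝ[X]) ^ d l) • (S l).map C)).coeff (d 3 + 2 * d 1))
    (hc₃ : c₃ = W (d 3 + d 0 + d 2) * (Matrix.det (∑ l, ((X : ℝ[X]) ^ d l) • (S l).map C)).coeff (d 3 + d 0 + d 2))
    (hc₄ : c₄ = W (d 3 + d 1 + d 2) * (Matrix.det (∑ l, ((X : ℝ[X]) ^ d l) • (S l).map C)).coeff (d 3 + d 1 + d 2))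
    (hc₅ : c₅ = W (d 3 + 2 * d 2) * (Matrix.det (∑ l, ((X : ℝ[X]) ^ d l) • (S l).map C)).coeff (d 3 + 2 * d 2)) :
    0 < c₅ * (c₀ * c₂ * c₅ + c₁ * c₃ * c₄ / 4 - c₀ * c₄ ^ 2 / 4 - c₂ * c₃ ^ 2 / 4 - c₅ * c₁ ^ 2 / 4)
      ∧ c₀ * (c₀ * c₂ * c₅ + c₁ * c₃ * c₄ / 4 - c₀ * c₄ ^ 2 / 4 - c₂ * c₃ ^ 2 / 4 - c₅ * c₁ ^ 2 / 4) < 0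
      ∧ c₂ * (c₀ * c₂ * c₅ + c₁ * c₃ * c₄ / 4 - c₀ * c₄ ^ 2 / 4 - c₂ * c₃ ^ 2 / 4 - c₅ * c₁ ^ 2 / 4) < 0 := by
  have ha0 : 0 < a := by have := hd (show (0 : Fin 4) < 1 by decide); omega
  have h5 := twistedMiddle_five_roots_of_nullTop_eighteen d hd S h3 h18 ha hb (by omega) W hW c₀ c₁ c₂ c₃ c₄ c₅ hc₀ hc₁ hc₂ hc₃ hc₄ hc₅
  exact orientation_eq_sign_gramDet a b ha0 hw c₀ c₁ c₂ c₃ c₄ c₅ h5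

/-- **TWISTED MIDDLE GRAM ORIENTATION OF A NULL-TOP EIGHTEEN — MIRROR-shaped core (`a < b < 2a`).**  Same data: `0 < c̃₀Δ̃`, `c̃₅Δ̃ < 0`, `c̃₂Δ̃ < 0`
(orientation reversed, `Census.orientation_eq_sign_gramDet_mirror`). [folklore] -/
theorem twistedMiddle_gram_orientation_of_nullTop_eighteen_mirror (d : Fin 4 → ℕ) (hd : StrictMono d)
    (S : Fin 4 → Matrix (Fin 3) (Fin 3) ℝ) (h3 : (S 3).det = 0)
    (h18 : 18 ≤ ((Matrix.det (∑ l, ((X : ℝ[X]) ^ d l) • (S l).map C)).roots.toFinset.filter (fun t => 0 < t)).card)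
    {a b : ℕ} (ha : d 1 = d 0 + a) (hb : d 2 = d 0 + b) (hnw : b < 2 * a)
    (W : ℕ → ℝ) (hW : ∀ n, W n =
      ∏ E ∈ ((((Finset.univ : Finset (Sym (Fin 4) 3)).erase (Sym.replicate 3 3)).filter
          (fun s : Sym (Fin 4) 3 => Multiset.count 3 (s : Multiset (Fin 4)) ≠ 1)).image
          (fun s : Sym (Fin 4) 3 => ((s : Multiset (Fin 4)).map d).sum)).image (fun m : ℕ => (m : ℝ)), ((n : ℝ) - E))
    (c₀ c₁ c₂ c₃ c₄ c₅ : ℝ)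
    (hc₀ : c₀ = W (d 3 + 2 * d 0) * (Matrix.det (∑ l, ((X : ℝ[X]) ^ d l) • (S l).map C)).coeff (d 3 + 2 * d 0))
    (hc₁ : c₁ = W (d 3 + d 0 + d 1) * (Matrix.det (∑ l, ((X : ℝ[X]) ^ d l) • (S l).map C)).coeff (d 3 + d 0 + d 1))
    (hc₂ : c₂ = W (d 3 + 2 * d 1) * (Matrix.det (∑ l, ((X : ℝ[X]) ^ d l) • (S l).map C)).coeff (d 3 + 2 * d 1))
    (hc₃ : c₃ = W (d 3 + d 0 + d 2) * (Matrix.det (∑ l, ((X : ℝ[X]) ^ d l) • (S l).map C)).coeff (d 3 + d 0 + d 2))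
    (hc₄ : c₄ = W (d 3 + d 1 + d 2) * (Matrix.det (∑ l, ((X : ℝ[X]) ^ d l) • (S l).map C)).coeff (d 3 + d 1 + d 2))
    (hc₅ : c₅ = W (d 3 + 2 * d 2) * (Matrix.det (∑ l, ((X : ℝ[X]) ^ d l) • (S l).map C)).coeff (d 3 + 2 * d 2)) :
    0 < c₀ * (c₀ * c₂ * c₅ + c₁ * c₃ * c₄ / 4 - c₀ * c₄ ^ 2 / 4 - c₂ * c₃ ^ 2 / 4 - c₅ * c₁ ^ 2 / 4)
      ∧ c₅ * (c₀ * c₂ * c₅ + c₁ * c₃ * c₄ / 4 - c₀ * c₄ ^ 2 / 4 - c₂ * c₃ ^ 2 / 4 - c₅ * c₁ ^ 2 / 4) < 0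
      ∧ c₂ * (c₀ * c₂ * c₅ + c₁ * c₃ * c₄ / 4 - c₀ * c₄ ^ 2 / 4 - c₂ * c₃ ^ 2 / 4 - c₅ * c₁ ^ 2 / 4) < 0 := by
  have hab : a < b := by have := hd (show (1 : Fin 4) < 2 by decide); omega
  have h5 := twistedMiddle_five_roots_of_nullTop_eighteen d hd S h3 h18 ha hb (by omega) W hW c₀ c₁ c₂ c₃ c₄ c₅ hc₀ hc₁ hc₂ hc₃ hc₄ hc₅
  exact orientation_eq_sign_gramDet_mirror a b hab hnw c₀ c₁ c₂ c₃ c₄ c₅ h5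

/-! ## 4. The six middle coefficients in letters -/

/-- **The middle window's coefficients in letters** (sorted support, any real letters, `det S₃ = 0`, `18` roots): the six slot coefficients at
`d₃ + 2d₀, d₃+d₀+d₁, d₃+2d₁, d₃+d₀+d₂, d₃+d₁+d₂, d₃+2d₂` are `tr(adj S₀·S₃)`, `tr(B(S₀,S₁)·S₃)`, `tr(adj S₁·S₃)`, `tr(B(S₀,S₂)·S₃)`, `tr(B(S₁,S₂)·S₃)`,
`tr(adj S₂·S₃)` with `B(X,Y) = adj(X+Y) − adj X − adj Y`. [folklore] -/
theorem middle_coeffs_eq_traces_of_nullTop_eighteen (d : Fin 4 → ℕ) (hd : StrictMono d) (S : Fin 4 → Matrix (Fin 3) (Fin 3) ℝ)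
    (h3 : (S 3).det = 0)
    (h18 : 18 ≤ ((Matrix.det (∑ l, ((X : ℝ[X]) ^ d l) • (S l).map C)).roots.toFinset.filter (fun t => 0 < t)).card) :
    (Matrix.det (∑ l, ((X : ℝ[X]) ^ d l) • (S l).map C)).coeff (d 3 + 2 * d 0) = ((S 0).adjugate * S 3).trace
      ∧ (Matrix.det (∑ l, ((X : ℝ[X]) ^ d l) • (S l).map C)).coeff (d 3 + d 0 + d 1)
          = (((S 0 + S 1).adjugate - (S 0).adjugate - (S 1).adjugate) * S 3).trace
      ∧ (Matrix.det (∑ l, ((X : ℝ[X]) ^ d l) • (S l).map C)).coeff (d 3 + 2 * d 1) = ((S 1).adjugate * S 3).trace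
      ∧ (Matrix.det (∑ l, ((X : ℝ[X]) ^ d l) • (S l).map C)).coeff (d 3 + d 0 + d 2)
          = (((S 0 + S 2).adjugate - (S 0).adjugate - (S 2).adjugate) * S 3).trace
      ∧ (Matrix.det (∑ l, ((X : ℝ[X]) ^ d l) • (S l).map C)).coeff (d 3 + d 1 + d 2)
          = (((S 1 + S 2).adjugate - (S 1).adjugate - (S 2).adjugate) * S 3).trace
      ∧ (Matrix.det (∑ l, ((X : ℝ[X]) ^ d l) • (S l).map C)).coeff (d 3 + 2 * d 2) = ((S 2).adjugate * S 3).trace := by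
  have hsq0 := (coeff_square_of_nullTop_eighteen d hd S h3 h18 0 3 (by decide)).1
  have hsq1 := (coeff_square_of_nullTop_eighteen d hd S h3 h18 1 3 (by decide)).1
  have hsq2 := (coeff_square_of_nullTop_eighteen d hd S h3 h18 2 3 (by decide)).1
  have hmx01 := (coeff_mixed_of_nullTop_eighteen d hd S h3 h18 0 1 3 (by decide) (by decide) (by decide)).1
  have hmx02 := (coeff_mixed_of_nullTop_eighteen d hd S h3 h18 0 2 3 (by decide) (by decide) (by decide)).1
  have hmx12 := (coeff_mixed_of_nullTop_eighteen d hd S h3 h18 1 2 3 (by decide) (by decide) (by decide)).1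
  refine ⟨?_, ?_, ?_, ?_, ?_, ?_⟩
  · rw [show d 3 + 2 * d 0 = 2 * d 0 + d 3 by omega]; exact hsq0
  · rw [show d 3 + d 0 + d 1 = d 0 + d 1 + d 3 by omega]; exact hmx01
  · rw [show d 3 + 2 * d 1 = 2 * d 1 + d 3 by omega]; exact hsq1
  · rw [show d 3 + d 0 + d 2 = d 0 + d 2 + d 3 by omega]; exact hmx02
  · rw [show d 3 + d 1 + d 2 = d 1 + d 2 + d 3 by omega]; exact hmx12
  · rw [show d 3 + 2 * d 2 = 2 * d 2 + d 3 by omega]; exact hsq2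

/-! ## 5. The certificate: the anti-oriented half of the generic sheet is closed -/

/-- **CERTIFICATE (window-shaped core `2(d₁−d₀) < d₂−d₀`).**  Sorted support, any real `3 × 3` letters, `det S₃ = 0`.  Let `W(n) = ∏ (n − σ(u))` over the exponents of
the thirteen non-middle sheet slots and let `c̃ᵢ = W(d₃+σᵢ)·τᵢ` with the LETTER data `τ = (tr(adj S₀·S₃), tr(B(S₀,S₁)·S₃), tr(adj S₁·S₃), tr(B(S₀,S₂)·S₃),
tr(B(S₁,S₂)·S₃), tr(adj S₂·S₃))`.  If the twisted middle window is NOT Gram-oriented, `c̃₅·Δ̃ ≤ 0`, then the pencil has at most `17` distinct positive roots —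
`stub_nullTopCeiling` holds on this closed half of the sheet, in every inertia cell and for every gap `d₃`. [folklore] -/
theorem posRoots_le_17_of_nullTop_of_twistedMiddle_antiOriented (d : Fin 4 → ℕ) (hd : StrictMono d)
    (S : Fin 4 → Matrix (Fin 3) (Fin 3) ℝ) (h3 : (S 3).det = 0)
    {a b : ℕ} (ha : d 1 = d 0 + a) (hb : d 2 = d 0 + b) (hw : 2 * a < b)
    (W : ℕ → ℝ) (hW : ∀ n, W n =
      ∏ E ∈ ((((Finset.univ : Finset (Sym (Fin 4) 3)).erase (Sym.replicate 3 3)).filter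
          (fun s : Sym (Fin 4) 3 => Multiset.count 3 (s : Multiset (Fin 4)) ≠ 1)).image
          (fun s : Sym (Fin 4) 3 => ((s : Multiset (Fin 4)).map d).sum)).image (fun m : ℕ => (m : ℝ)), ((n : ℝ) - E))
    (c₀ c₁ c₂ c₃ c₄ c₅ : ℝ)
    (hc₀ : c₀ = W (d 3 + 2 * d 0) * ((S 0).adjugate * S 3).trace)
    (hc₁ : c₁ = W (d 3 + d 0 + d 1) * (((S 0 + S 1).adjugate - (S 0).adjugate - (S 1).adjugate) * S 3).trace)
    (hc₂ : c₂ = W (d 3 + 2 * d 1) * ((S 1).adjugate * S 3).trace)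
    (hc₃ : c₃ = W (d 3 + d 0 + d 2) * (((S 0 + S 2).adjugate - (S 0).adjugate - (S 2).adjugate) * S 3).trace)
    (hc₄ : c₄ = W (d 3 + d 1 + d 2) * (((S 1 + S 2).adjugate - (S 1).adjugate - (S 2).adjugate) * S 3).trace)
    (hc₅ : c₅ = W (d 3 + 2 * d 2) * ((S 2).adjugate * S 3).trace)
    (hanti : c₅ * (c₀ * c₂ * c₅ + c₁ * c₃ * c₄ / 4 - c₀ * c₄ ^ 2 / 4 - c₂ * c₃ ^ 2 / 4 - c₅ * c₁ ^ 2 / 4) ≤ 0) :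
    ((Matrix.det (∑ l, ((X : ℝ[X]) ^ d l) • (S l).map C)).roots.toFinset.filter (fun t => 0 < t)).card ≤ 17 := by
  by_contra hlt
  have h18 : 18 ≤ ((Matrix.det (∑ l, ((X : ℝ[X]) ^ d l) • (S l).map C)).roots.toFinset.filter (fun t => 0 < t)).card := by omega
  obtain ⟨e0, e1, e2, e3, e4, e5⟩ := middle_coeffs_eq_traces_of_nullTop_eighteen d hd S h3 h18
  have h := (twistedMiddle_gram_orientation_of_nullTop_eighteen d hd S h3 h18 ha hb hw W hW c₀ c₁ c₂ c₃ c₄ c₅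
    (by rw [e0]; exact hc₀) (by rw [e1]; exact hc₁) (by rw [e2]; exact hc₂) (by rw [e3]; exact hc₃) (by rw [e4]; exact hc₄)
    (by rw [e5]; exact hc₅)).1
  linarith

/-- **CERTIFICATE (mirror-shaped core `d₂ − d₀ < 2(d₁ − d₀)`).**  Same letter data; if `c̃₀·Δ̃ ≤ 0` then at most `17` distinct positive roots. [folklore] -/
theorem posRoots_le_17_of_nullTop_of_twistedMiddle_antiOriented_mirror (d : Fin 4 → ℕ) (hd : StrictMono d)
    (S : Fin 4 → Matrix (Fin 3) (Fin 3) ℝ) (h3 : (S 3).det = 0)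
    {a b : ℕ} (ha : d 1 = d 0 + a) (hb : d 2 = d 0 + b) (hnw : b < 2 * a)
    (W : ℕ → ℝ) (hW : ∀ n, W n =
      ∏ E ∈ ((((Finset.univ : Finset (Sym (Fin 4) 3)).erase (Sym.replicate 3 3)).filter
          (fun s : Sym (Fin 4) 3 => Multiset.count 3 (s : Multiset (Fin 4)) ≠ 1)).image
          (fun s : Sym (Fin 4) 3 => ((s : Multiset (Fin 4)).map d).sum)).image (fun m : ℕ => (m : ℝ)), ((n : ℝ) - E))
    (c₀ c₁ c₂ c₃ c₄ c₅ : ℝ)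
    (hc₀ : c₀ = W (d 3 + 2 * d 0) * ((S 0).adjugate * S 3).trace)
    (hc₁ : c₁ = W (d 3 + d 0 + d 1) * (((S 0 + S 1).adjugate - (S 0).adjugate - (S 1).adjugate) * S 3).trace)
    (hc₂ : c₂ = W (d 3 + 2 * d 1) * ((S 1).adjugate * S 3).trace)
    (hc₃ : c₃ = W (d 3 + d 0 + d 2) * (((S 0 + S 2).adjugate - (S 0).adjugate - (S 2).adjugate) * S 3).trace)
    (hc₄ : c₄ = W (d 3 + d 1 + d 2) * (((S 1 + S 2).adjugate - (S 1).adjugate - (S 2).adjugate) * S 3).trace)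
    (hc₅ : c₅ = W (d 3 + 2 * d 2) * ((S 2).adjugate * S 3).trace)
    (hanti : c₀ * (c₀ * c₂ * c₅ + c₁ * c₃ * c₄ / 4 - c₀ * c₄ ^ 2 / 4 - c₂ * c₃ ^ 2 / 4 - c₅ * c₁ ^ 2 / 4) ≤ 0) :
    ((Matrix.det (∑ l, ((X : ℝ[X]) ^ d l) • (S l).map C)).roots.toFinset.filter (fun t => 0 < t)).card ≤ 17 := by
  by_contra hlt
  have h18 : 18 ≤ ((Matrix.det (∑ l, ((X : ℝ[X]) ^ d l) • (S l).map C)).roots.toFinset.filter (fun t => 0 < t)).card := by omega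
  obtain ⟨e0, e1, e2, e3, e4, e5⟩ := middle_coeffs_eq_traces_of_nullTop_eighteen d hd S h3 h18
  have h := (twistedMiddle_gram_orientation_of_nullTop_eighteen_mirror d hd S h3 h18 ha hb hnw W hW c₀ c₁ c₂ c₃ c₄ c₅
    (by rw [e0]; exact hc₀) (by rw [e1]; exact hc₁) (by rw [e2]; exact hc₂) (by rw [e3]; exact hc₃) (by rw [e4]; exact hc₄)
    (by rw [e5]; exact hc₅)).1
  linarith

end Summit.ValiantsHypothesis.ValiantsHypothesis.Theorems.LacunarySymmetroidMatrixDescartes.Census
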